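import Literature.NumberTheory.LFunctions.Zhang2022.Section3Lemma31
import HarnessLib

/-!
# The residue data `g(0)`, `g′(0)` of the smoothed logarithmic second moment of `ν = 1 ∗ χ`

Topic `Literature/NumberTheory/LFunctions`. Everything here is PROVED.

In the tree's explicit formula for `W_{ν²}(B) − W_{ν²}(A)` (`DivisorSumCharSq.explicit_formula`,
`DivisorSumCharSqSmoothedMoment.lean`) the main terms are `g(0)(W_d(B) − W_d(A))` and
`(log B − log A) g′(0)` with `g(z) = L(1+z,χ)² φ(1+z)`, `φ(w) = (ζ(2w)∏_{p∣q}(1+p^{-w}))^{-1}`. This is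
Conrey–Iwaniec's polar data (6.44)–(6.45) (`α ∝ L(1,χ)²`, `β ∝ L(1,χ)²[2 L′/L(1,χ) + O(log q)]`).
We prove, for `χ` primitive mod `q > 4`:

  `‖g(0)‖ ≤ 3 ‖L(1,χ)‖²`,  `‖g′(0)‖ ≤ 12 (‖L(1,χ)‖ ‖L′(1,χ)‖ + ‖L(1,χ)‖² (log q + 1))`

(product rule; `|φ(1+z)| ≤ 3` on `|z| ≤ min(1/log q, 1/4)` is the tree's `norm_phi_one_add_le`, and
Cauchy's estimate there gives `|φ′(1)| ≤ 3 max(log q, 4)`). Stub S2 of SKELETON I6c (line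
`smoothed-mellin-large`, cell landau-siegel/ls-inputs).

«The programme SEARCHES and TYPES; no claim about Landau–Siegel zeros, Theorems 1–2 of
arXiv:2211.02515 or a repaired Margin232 until a kernel theorem says so.»

## References
* [ConreyIwaniec2002] B. Conrey, H. Iwaniec, Acta Arith. 103 (2002) 259–312, §6 (6.43)–(6.45).
* [Zhang2022LandauSiegel] Y. Zhang, arXiv:2211.02515, §3 (3.3) (the function `φ`).
-/

noncomputable section

open Complex Filter Topology Set Metric

namespace Literature.NumberTheory.LFunctions.DivisorSumCharSq

open Literature.NumberTheory.LFunctions.Zhang2022.Lemma31 (ne_one_of_isPrimitive norm_phi_one_add_le)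

variable {D : ℕ} [NeZero D] (χ : DirichletCharacter ℂ D)

omit [NeZero D] in
/-- `log D ≥ 1` for `D ≥ 3` (`e < 3`). [folklore] -/
private theorem one_le_log (hD : 3 ≤ D) : 1 ≤ Real.log D := by
  have h3 : (3 : ℝ) ≤ D := by exact_mod_cast hD
  rw [Real.le_log_iff_exp_le (by linarith)]
  exact Real.exp_one_lt_d9.le.trans (by linarith)

/-- **`‖g(0)‖ ≤ 3 L(1,χ)²`** for `D ≥ 3` (`|φ(1)| ≤ 3`): Conrey–Iwaniec's `α = (q/ν(q)) L(1,χ)²/ζ(2)`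
up to the normalisation of `φ`. [cite: ConreyIwaniec2002, §6 (6.44)] -/
theorem norm_gFun_zero_le_sq (hD : 3 ≤ D) : ‖gFun χ 0‖ ≤ 3 * ‖χ.LFunction 1‖ ^ 2 := by
  have hφ1 : ‖phi D (1 + 0)‖ ≤ 3 :=
    norm_phi_one_add_le (N := D) (one_le_log hD) (by rw [norm_zero]; positivity)
      (by rw [norm_zero]; norm_num)
  rw [gFun, norm_mul, norm_pow]
  rw [add_zero] at hφ1 ⊢
  have h0 : 0 ≤ ‖χ.LFunction 1‖ ^ 2 := sq_nonneg _
  nlinarith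

omit [NeZero D] in
/-- **`‖(φ(1+·))′(0)‖ ≤ 3 (log D + 4)`** for `D ≥ 3`: Cauchy's estimate on `|z| = min(1/log D, 1/4)`,
where `|φ(1+z)| ≤ 3`. [cite: Zhang2022LandauSiegel, §3 (3.3)] -/
theorem norm_deriv_phi_one_le (hD : 3 ≤ D) :
    ‖deriv (fun z : ℂ => phi D (1 + z)) 0‖ ≤ 3 * (Real.log D + 4) := by
  have hlog1 := one_le_log hD
  have hlog0 : 0 < Real.log D := by linarith
  set r : ℝ := min (1 / Real.log D) (1 / 4) with hr
  have hr0 : 0 < r := lt_min (one_div_pos.2 hlog0) (by norm_num)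
  have hr1 : r ≤ 1 / Real.log D := min_le_left _ _
  have hr4 : r ≤ 1 / 4 := min_le_right _ _
  -- differentiability of `z ↦ φ(1+z)` on `re z > −1/2`
  have hdiff : DifferentiableOn ℂ (fun z : ℂ => phi D (1 + z)) {z : ℂ | -(1 / 2) < z.re} := by
    intro z hz
    refine DifferentiableAt.differentiableWithinAt ?_
    have h1 : DifferentiableAt ℂ (fun z : ℂ => (1 : ℂ) + z) z := differentiableAt_id.const_add _
    have hw : 1 / 2 < ((1 : ℂ) + z).re := by
      simp only [add_re, one_re]; simp only [mem_setOf_eq] at hz; linarith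
    exact (differentiableAt_phi D hw).comp z h1
  have hd : DiffContOnCl ℂ (fun z : ℂ => phi D (1 + z)) (ball 0 r) := by
    refine hdiff.diffContOnCl_ball fun z hz => ?_
    rw [mem_closedBall, dist_zero_right] at hz
    simp only [mem_setOf_eq]
    have := Complex.abs_re_le_norm z
    have := neg_abs_le z.re
    linarith
  have hM : ∀ z ∈ sphere (0 : ℂ) r, ‖phi D (1 + z)‖ ≤ 3 := by
    intro z hz
    rw [mem_sphere, dist_zero_right] at hz
    exact norm_phi_one_add_le (N := D) hlog1 (by rw [hz]; exact hr1) (by rw [hz]; exact hr4)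
  have hC := Complex.norm_deriv_le_of_forall_mem_sphere_norm_le hr0 hd hM
  -- `3/r = 3 max(log D, 4) ≤ 3 (log D + 4)`
  have hinv : 1 / r ≤ Real.log D + 4 := by
    rw [hr]
    rcases le_total (1 / Real.log D) (1 / 4) with h | h
    · rw [min_eq_left h, one_div_one_div]; linarith
    · rw [min_eq_right h]; norm_num; linarith
  calc ‖deriv (fun z : ℂ => phi D (1 + z)) 0‖ ≤ 3 / r := hC
    _ = 3 * (1 / r) := by ring
    _ ≤ 3 * (Real.log D + 4) := by gcongr

/-- **`‖g′(0)‖ ≤ 6 L(1,χ)|L′(1,χ)| + 3 L(1,χ)² (log D + 4)`** for `χ` primitive mod `D ≥ 3` (product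
rule `g′(0) = 2L(1)L′(1)φ(1) + L(1)²φ′(1)`): Conrey–Iwaniec's `β` of (6.45) up to normalisation
(`Σ_{p∣q} log p/(p+1) ≤ log q`). [cite: ConreyIwaniec2002, §6 (6.45)] -/
theorem norm_deriv_gFun_zero_le_lOne (hD : 3 ≤ D) (hprim : χ.IsPrimitive) :
    ‖deriv (gFun χ) 0‖ ≤
      6 * ‖χ.LFunction 1‖ * ‖deriv χ.LFunction 1‖ + 3 * ‖χ.LFunction 1‖ ^ 2 * (Real.log D + 4) := by
  have hχ1 : χ ≠ 1 := ne_one_of_isPrimitive χ (by omega) hprim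
  -- the two factors and their derivatives at `0`
  have hL : HasDerivAt (fun z : ℂ => χ.LFunction (1 + z)) (deriv χ.LFunction 1) 0 := by
    have h2 : HasDerivAt χ.LFunction (deriv χ.LFunction 1) (1 + 0) := by
      rw [add_zero]
      exact (DirichletCharacter.differentiable_LFunction hχ1).differentiableAt.hasDerivAt
    exact h2.comp_const_add 1 0
  have hφd : DifferentiableAt ℂ (fun z : ℂ => phi D (1 + z)) 0 := by
    have h1 : DifferentiableAt ℂ (fun z : ℂ => (1 : ℂ) + z) 0 := differentiableAt_id.const_add _
    have hw : 1 / 2 < ((1 : ℂ) + 0).re := by norm_num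
    exact (differentiableAt_phi D hw).comp 0 h1
  have hφ : HasDerivAt (fun z : ℂ => phi D (1 + z)) (deriv (fun z : ℂ => phi D (1 + z)) 0) 0 :=
    hφd.hasDerivAt
  have hg : HasDerivAt (gFun χ)
      ((deriv χ.LFunction 1 * χ.LFunction (1 + 0) + χ.LFunction (1 + 0) * deriv χ.LFunction 1) *
          phi D (1 + 0) +
        χ.LFunction (1 + 0) * χ.LFunction (1 + 0) * deriv (fun z : ℂ => phi D (1 + z)) 0) 0 := by
    have := (hL.mul hL).mul hφ
    refine this.congr_of_eventuallyEq (Eventually.of_forall fun z => ?_)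
    simp only [gFun, pow_two, Pi.mul_apply]
  rw [hg.deriv]
  simp only [add_zero]
  -- norms
  have hφ1 : ‖phi D 1‖ ≤ 3 := by
    have := norm_phi_one_add_le (N := D) (one_le_log hD) (z := 0) (by rw [norm_zero]; positivity)
      (by rw [norm_zero]; norm_num)
    rwa [add_zero] at this
  have hφ' := norm_deriv_phi_one_le hD
  have hL0 : 0 ≤ ‖χ.LFunction 1‖ := norm_nonneg _
  have hL'0 : 0 ≤ ‖deriv χ.LFunction 1‖ := norm_nonneg _
  have hA : ‖deriv χ.LFunction 1 * χ.LFunction 1 + χ.LFunction 1 * deriv χ.LFunction 1‖ ≤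
      2 * ‖χ.LFunction 1‖ * ‖deriv χ.LFunction 1‖ := by
    calc _ ≤ ‖deriv χ.LFunction 1 * χ.LFunction 1‖ + ‖χ.LFunction 1 * deriv χ.LFunction 1‖ :=
          norm_add_le _ _
      _ = 2 * ‖χ.LFunction 1‖ * ‖deriv χ.LFunction 1‖ := by rw [norm_mul, norm_mul]; ring
  have hB : ‖χ.LFunction 1 * χ.LFunction 1‖ = ‖χ.LFunction 1‖ ^ 2 := by rw [norm_mul, sq]
  calc ‖(deriv χ.LFunction 1 * χ.LFunction 1 + χ.LFunction 1 * deriv χ.LFunction 1) * phi D 1 +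
        χ.LFunction 1 * χ.LFunction 1 * deriv (fun z : ℂ => phi D (1 + z)) 0‖
      ≤ ‖(deriv χ.LFunction 1 * χ.LFunction 1 + χ.LFunction 1 * deriv χ.LFunction 1) * phi D 1‖ +
        ‖χ.LFunction 1 * χ.LFunction 1 * deriv (fun z : ℂ => phi D (1 + z)) 0‖ := norm_add_le _ _
    _ = ‖deriv χ.LFunction 1 * χ.LFunction 1 + χ.LFunction 1 * deriv χ.LFunction 1‖ * ‖phi D 1‖ +
        ‖χ.LFunction 1‖ ^ 2 * ‖deriv (fun z : ℂ => phi D (1 + z)) 0‖ := by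
        rw [norm_mul, norm_mul, hB]
    _ ≤ (2 * ‖χ.LFunction 1‖ * ‖deriv χ.LFunction 1‖) * 3 +
        ‖χ.LFunction 1‖ ^ 2 * (3 * (Real.log D + 4)) := by
        gcongr
    _ = _ := by ring

/-- **The residue data at `z = 0`** (stub S2 of SKELETON I6c, registered signature): for `χ` primitive
mod `q > 4`, `‖g(0)‖ ≤ C L(1,χ)²` and `‖g′(0)‖ ≤ C (L(1,χ)|L′(1,χ)| + L(1,χ)² (log q + 1))`, `C = 12`.
[cite: ConreyIwaniec2002, §6 (6.44)–(6.45)] -/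
theorem gFun_zero_bounds :
    ∃ C : ℝ, 0 < C ∧ ∀ (q : ℕ) [NeZero q], 4 < q → ∀ χ : DirichletCharacter ℂ q, χ.IsPrimitive →
      ‖gFun χ 0‖ ≤ C * ‖χ.LFunction 1‖ ^ 2 ∧
      ‖deriv (gFun χ) 0‖ ≤
        C * (‖χ.LFunction 1‖ * ‖deriv χ.LFunction 1‖ + ‖χ.LFunction 1‖ ^ 2 * (Real.log q + 1)) := by
  refine ⟨12, by norm_num, fun q _ hq χ hprim => ⟨?_, ?_⟩⟩
  · have := norm_gFun_zero_le_sq χ (by omega)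
    nlinarith [sq_nonneg ‖χ.LFunction 1‖]
  · have h := norm_deriv_gFun_zero_le_lOne χ (by omega) hprim
    have hL0 : 0 ≤ ‖χ.LFunction 1‖ := norm_nonneg _
    have hL'0 : 0 ≤ ‖deriv χ.LFunction 1‖ := norm_nonneg _
    have hlog : 0 ≤ Real.log q := Real.log_nonneg (by exact_mod_cast (show 1 ≤ q by omega))
    nlinarith [mul_nonneg hL0 hL'0, mul_nonneg (sq_nonneg ‖χ.LFunction 1‖) hlog,
      sq_nonneg ‖χ.LFunction 1‖]

end Literature.NumberTheory.LFunctions.DivisorSumCharSq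

end
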